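import Literature.Analysis.ODE.WeaklySingularGronwallZero
import HarnessLib

/-!
# Henry's singular Grönwall inequality (LNM 840, Lemma 7.1.1) with constant / non-decreasing data

Analysis/ODE support file (pure real analysis, everything proved; no definitions).  The weakly
singular Grönwall inequality of D. Henry, *Geometric Theory of Semilinear Parabolic Equations*,
LNM 840 (1981), Lemma 7.1.1, in the form consumed by the uniqueness, Lipschitz stability and
continuation of mild solutions of semilinear parabolic equations (Henry, §§3.3–3.4; the kernel
`(t − s)^{−α}` is the bound `‖A^α e^{−(t−s)A}‖ ≤ C_α (t − s)^{−α}`): for `α < 1` and every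
coefficient `M` and horizon `τ` there is a constant `C = C(α, M, τ) ≥ 1` such that whenever `d ≥ 0`
is continuous on `[0, τ]` and

  `d(t) ≤ A + M ∫₀ᵗ (t − s)^{−α} d(s) ds`  for `t ∈ [0, τ]`,

then `d(t) ≤ C A` on `[0, τ]`.

* `singular_gronwall_uniform` — the workhorse: ONE constant `C(α, M, τ)` serves every horizon
  `τ' ≤ τ` (the inequality and the conclusion on `[0, τ']`);
* `singular_gronwall_const` — the fixed-horizon statement displayed above;
* `singular_gronwall_monotone` — non-decreasing data `a` in place of the constant `A`:
  `d(t) ≤ a(t) + M ∫₀ᵗ (t − s)^{−α} d(s) ds` on `[0, τ]` gives `d(t) ≤ C a(t)` (freeze `a` at `t`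
  and use the uniform statement on `[0, t]`);
* `integral_sub_rpow_neg_le` — the kernel mass `∫₀^{a} (t − s)^{−α} ds ≤ t^{1−α}/(1−α)` for `a ≤ t`.

No sign condition on `M` or `A` is needed (the integral is nonnegative, so `M` may be replaced by
`max M 1`; `A ≥ d(0) ≥ 0` unless `[0, τ]` is empty), and `α < 0` (a bounded kernel) is allowed.

Proof (elementary, no Mittag-Leffler series; the same device as the homogeneous case
`eq_zero_of_le_mul_integral_rpow_neg_mul` of `WeaklySingularGronwallZero.lean`): induction over the
windows `[kδ, (k+1)δ]` with `M' δ^{1−α}/(1−α) = 1/2`, `M' = max M 1`.  If `d ≤ L^k A` on `[0, kδ]`,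
then at a maximum point `t*` of `d` on the next window, splitting `∫₀^{t*} = ∫₀^{kδ} + ∫_{kδ}^{t*}`,
`d(t*) ≤ A + M' K L^k A + d(t*)/2` with `K = τ^{1−α}/(1−α) ≥ ∫₀^{kδ} (t* − s)^{−α} ds`, whence
`d ≤ 2(1 + M' K) L^k A = L^{k+1} A` on the window for `L := 2(1 + M' K)`; so `C := L^N` with
`N = ⌈τ/δ⌉`.  (Henry iterates the inequality and sums the resulting series; his sharper constant, of
Mittag-Leffler type `E_{1−α}(θ t)` with `θ = (M Γ(1−α))^{1/(1−α)}`, is not needed by the consumers,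
which only use that `C` depends on `(α, M, τ)` alone.)

Mathlib has the differential Grönwall inequality (`Mathlib.Analysis.ODE.Gronwall`, `gronwallBound`)
only; the tree has the integral form with a regular kernel
(`Literature.Analysis.ODE.gronwall_integral_le`), the nonlinear / endpoint-fractional lemmas of
Coiculescu–Palasek with the kernel `(t − s)^{−1/2}` (`Literature.Analysis.ODE.fractional_gronwall`),
and the homogeneous case `A = 0` of the present lemma
(`Literature.Analysis.ODE.eq_zero_of_le_mul_integral_rpow_neg_mul`, whose interval-integrability and
kernel-mass tools `intervalIntegrable_sub_rpow_neg_mul`, `integral_sub_rpow_neg` are reused here).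

## References

* D. Henry, *Geometric Theory of Semilinear Parabolic Equations*, Lecture Notes in Mathematics 840,
  Springer (1981), §7.1, Lemma 7.1.1 (used in §3.3 for uniqueness and continuous dependence of mild
  solutions). [`Henry1981`]
-/
noncomputable section

open Set Filter MeasureTheory intervalIntegral

namespace Literature.Analysis.ODE

/-- The mass of the weakly singular kernel over an initial segment: for `α < 1` and `a ≤ t`,
`∫₀^{a} (t − s)^{−α} ds = (t^{1−α} − (t − a)^{1−α})/(1 − α) ≤ t^{1−α}/(1 − α)`. [folklore] -/
theorem integral_sub_rpow_neg_le {α : ℝ} (hα : α < 1) {a t : ℝ} (hat : a ≤ t) :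
    ∫ s in (0 : ℝ)..a, (t - s) ^ (-α) ≤ t ^ (1 - α) / (1 - α) := by
  rw [intervalIntegral.integral_comp_sub_left (fun x : ℝ => x ^ (-α)) t, sub_zero,
    integral_rpow (Or.inl (by linarith)), neg_add_eq_sub]
  have h1 : 0 ≤ (t - a) ^ (1 - α) := Real.rpow_nonneg (sub_nonneg.2 hat) _
  have h2 : 0 < 1 - α := by linarith
  exact div_le_div_of_nonneg_right (sub_le_self _ h1) h2.le

/-- **Henry's singular Grönwall inequality, uniformly in the horizon** (Henry 1981, Lemma 7.1.1
with constant data).  For `α < 1` and all `M`, `τ` there is `C ≥ 1` (depending on `α, M, τ` only)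
such that for every horizon `τ' ≤ τ`, every `A` and every `d` continuous and nonnegative on
`[0, τ']` with `d(t) ≤ A + M ∫₀ᵗ (t − s)^{−α} d(s) ds` for all `t ∈ [0, τ']`, one has `d(t) ≤ C A`
for all `t ∈ [0, τ']`.  Proof by induction over windows of length `δ` with
`max(M,1) δ^{1−α}/(1−α) = 1/2`: the bound grows by the factor `L = 2(1 + max(M,1) τ^{1−α}/(1−α))`
per window, `C = L^⌈τ/δ⌉`. [cite: Henry1981, Lemma 7.1.1] -/
theorem singular_gronwall_uniform {α : ℝ} (hα : α < 1) (M τ : ℝ) :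
    ∃ C : ℝ, 1 ≤ C ∧ ∀ τ' ≤ τ, ∀ (A : ℝ) (d : ℝ → ℝ), ContinuousOn d (Icc 0 τ') →
      (∀ t ∈ Icc 0 τ', 0 ≤ d t) →
      (∀ t ∈ Icc 0 τ', d t ≤ A + M * ∫ s in (0 : ℝ)..t, (t - s) ^ (-α) * d s) →
      ∀ t ∈ Icc 0 τ', d t ≤ C * A := by
  have hα1 : 0 < 1 - α := by linarith
  -- the empty interval
  rcases lt_or_ge τ 0 with hτ | hτ
  · exact ⟨1, le_rfl, fun τ' hτ' A d _ _ _ t ht =>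
      (lt_irrefl _ ((((ht.1.trans ht.2).trans hτ').trans_lt hτ))).elim⟩
  -- a positive coefficient `M' ≥ M`
  set M' : ℝ := max M 1 with hM'
  have hM'0 : 0 < M' := lt_of_lt_of_le zero_lt_one (le_max_right _ _)
  -- the window length `δ` (`M' δ^{1-α}/(1-α) = 1/2`), a bound `K` for the kernel mass
  -- `∫₀^a (t-s)^{-α} ds`, `a ≤ t ≤ τ`, the growth factor `L` per window, the number `N` of windows
  set δ : ℝ := ((1 - α) / (2 * M')) ^ (1 - α)⁻¹ with hδ
  have hδ0 : 0 < δ := Real.rpow_pos_of_pos (by positivity) _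
  have hδpow : δ ^ (1 - α) = (1 - α) / (2 * M') := Real.rpow_inv_rpow (by positivity) hα1.ne'
  have hq : M' * (δ ^ (1 - α) / (1 - α)) = 1 / 2 := by
    rw [hδpow]; field_simp
  obtain ⟨K, hK0, hKle⟩ :
      ∃ K : ℝ, 0 ≤ K ∧ ∀ t : ℝ, 0 ≤ t → t ≤ τ → t ^ (1 - α) / (1 - α) ≤ K :=
    ⟨τ ^ (1 - α) / (1 - α), div_nonneg (Real.rpow_nonneg hτ _) hα1.le, fun t ht0 htτ =>
      div_le_div_of_nonneg_right (Real.rpow_le_rpow ht0 htτ hα1.le) hα1.le⟩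
  obtain ⟨L, hL⟩ : ∃ L : ℝ, L = 2 * (1 + M' * K) := ⟨_, rfl⟩
  have hL1 : 1 ≤ L := by rw [hL]; nlinarith [mul_nonneg hM'0.le hK0]
  have hL0 : 0 ≤ L := zero_le_one.trans hL1
  obtain ⟨N, hN⟩ : ∃ N : ℕ, τ ≤ N * δ := ⟨⌈τ / δ⌉₊, (div_le_iff₀ hδ0).1 (Nat.le_ceil _)⟩
  refine ⟨L ^ N, one_le_pow₀ hL1, fun τ' hτ' A d hd hd0 hle t₀ ht₀ => ?_⟩
  -- nonnegativity of the integral, the inequality with `M'`, and `0 ≤ A`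
  have hInonneg : ∀ t ∈ Icc 0 τ', 0 ≤ ∫ s in (0 : ℝ)..t, (t - s) ^ (-α) * d s := fun t ht =>
    intervalIntegral.integral_nonneg ht.1 fun s hs =>
      mul_nonneg (Real.rpow_nonneg (sub_nonneg.2 hs.2) _) (hd0 s ⟨hs.1, hs.2.trans ht.2⟩)
  have hle' : ∀ t ∈ Icc 0 τ', d t ≤ A + M' * ∫ s in (0 : ℝ)..t, (t - s) ^ (-α) * d s :=
    fun t ht => (hle t ht).trans
      (add_le_add_right (mul_le_mul_of_nonneg_right (le_max_left _ _) (hInonneg t ht)) _)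
  have hA : 0 ≤ A := by
    have h0 : (0 : ℝ) ∈ Icc 0 τ' := ⟨le_rfl, ht₀.1.trans ht₀.2⟩
    have h := hle 0 h0
    rw [intervalIntegral.integral_same, mul_zero, add_zero] at h
    exact (hd0 0 h0).trans h
  -- induction over the windows `[k δ, (k + 1) δ]`
  suffices key : ∀ k : ℕ, ∀ t ∈ Icc 0 τ', t ≤ k * δ → d t ≤ L ^ k * A from
    key N t₀ ht₀ (ht₀.2.trans (hτ'.trans hN))
  intro k
  induction k with
  | zero =>
    intro t ht hle0
    rw [Nat.cast_zero, zero_mul] at hle0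
    have ht0 : t = 0 := le_antisymm hle0 ht.1
    have h := hle t ht
    rw [ht0, intervalIntegral.integral_same, mul_zero, add_zero] at h
    rw [pow_zero, one_mul, ht0]
    exact h
  | succ k ih =>
    intro t ht htk
    set t₁ : ℝ := k * δ with ht₁
    rcases le_or_gt t t₁ with h | h
    · exact (ih t ht h).trans (mul_le_mul_of_nonneg_right (pow_le_pow_right₀ hL1 k.le_succ) hA)
    -- the window `W = [t₁, min τ' (t₁ + δ)]` is nonempty and compact; `d` attains its maximum `S`
    have ht₁0 : 0 ≤ t₁ := by positivity
    have htk' : t ≤ t₁ + δ := by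
      calc t ≤ ((k + 1 : ℕ) : ℝ) * δ := htk
        _ = t₁ + δ := by push_cast; ring
    set W : Set ℝ := Icc t₁ (min τ' (t₁ + δ)) with hW
    have hWsub : W ⊆ Icc 0 τ' := fun s hs => ⟨ht₁0.trans hs.1, hs.2.trans (min_le_left _ _)⟩
    have htW : t ∈ W := ⟨h.le, le_min ht.2 htk'⟩
    obtain ⟨tm, htmW, htm⟩ := isCompact_Icc.exists_isMaxOn ⟨t, htW⟩ (hd.mono hWsub)
    set S : ℝ := d tm with hS
    have hS0 : 0 ≤ S := hd0 tm (hWsub htmW)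
    have hdS : ∀ s ∈ W, d s ≤ S := fun s hs => htm hs
    have htm0 : t₁ ≤ tm := htmW.1
    have htmτ : tm ∈ Icc 0 τ' := hWsub htmW
    have hLA : 0 ≤ L ^ k * A := mul_nonneg (pow_nonneg hL0 _) hA
    -- splitting `∫₀^{tm} = ∫₀^{t₁} + ∫_{t₁}^{tm}`
    have hcont0 : ContinuousOn d (uIcc 0 t₁) := by
      rw [uIcc_of_le ht₁0]; exact hd.mono (Icc_subset_Icc_right (htm0.trans htmτ.2))
    have hcont1 : ContinuousOn d (uIcc t₁ tm) := by
      rw [uIcc_of_le htm0]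
      exact hd.mono ((Icc_subset_Icc_left ht₁0).trans (Icc_subset_Icc_right htmτ.2))
    have hi0 := intervalIntegrable_sub_rpow_neg_mul hα tm hcont0
    have hi1 := intervalIntegrable_sub_rpow_neg_mul hα tm hcont1
    have hsplit : ∫ s in (0 : ℝ)..tm, (tm - s) ^ (-α) * d s =
        (∫ s in (0 : ℝ)..t₁, (tm - s) ^ (-α) * d s) + ∫ s in t₁..tm, (tm - s) ^ (-α) * d s :=
      (intervalIntegral.integral_add_adjacent_intervals hi0 hi1).symm
    -- the past `[0, t₁]`, where `d ≤ L ^ k A` by the induction hypothesis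
    have hpast : ∫ s in (0 : ℝ)..t₁, (tm - s) ^ (-α) * d s ≤ K * (L ^ k * A) := by
      calc ∫ s in (0 : ℝ)..t₁, (tm - s) ^ (-α) * d s
          ≤ ∫ s in (0 : ℝ)..t₁, (tm - s) ^ (-α) * (L ^ k * A) := by
            refine intervalIntegral.integral_mono_on ht₁0 hi0 ?_ fun s hs => ?_
            · exact (intervalIntegrable_sub_rpow_neg_mul hα tm continuousOn_const :)
            · exact mul_le_mul_of_nonneg_left (ih s ⟨hs.1, hs.2.trans (htm0.trans htmτ.2)⟩ hs.2)
                (Real.rpow_nonneg (sub_nonneg.2 (hs.2.trans htm0)) _)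
        _ = (∫ s in (0 : ℝ)..t₁, (tm - s) ^ (-α)) * (L ^ k * A) := by
            rw [intervalIntegral.integral_mul_const]
        _ ≤ tm ^ (1 - α) / (1 - α) * (L ^ k * A) :=
            mul_le_mul_of_nonneg_right (integral_sub_rpow_neg_le hα htm0) hLA
        _ ≤ K * (L ^ k * A) :=
            mul_le_mul_of_nonneg_right (hKle tm htmτ.1 (htmτ.2.trans hτ')) hLA
    -- the window `[t₁, tm]`, where `d ≤ S`
    have hwin : ∫ s in t₁..tm, (tm - s) ^ (-α) * d s ≤ S * (δ ^ (1 - α) / (1 - α)) := by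
      calc ∫ s in t₁..tm, (tm - s) ^ (-α) * d s ≤ ∫ s in t₁..tm, (tm - s) ^ (-α) * S := by
            refine intervalIntegral.integral_mono_on htm0 hi1 ?_ fun s hs => ?_
            · exact (intervalIntegrable_sub_rpow_neg_mul hα tm continuousOn_const :)
            · exact mul_le_mul_of_nonneg_left
                (hdS s ⟨hs.1, le_min (hs.2.trans htmτ.2)
                  ((hs.2.trans htmW.2).trans (min_le_right _ _))⟩)
                (Real.rpow_nonneg (sub_nonneg.2 hs.2) _)
        _ = (tm - t₁) ^ (1 - α) / (1 - α) * S := by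
            rw [intervalIntegral.integral_mul_const, integral_sub_rpow_neg hα t₁ tm]
        _ ≤ δ ^ (1 - α) / (1 - α) * S := by
            have h1 : tm - t₁ ≤ δ := by linarith [htmW.2.trans (min_le_right τ' (t₁ + δ))]
            exact mul_le_mul_of_nonneg_right (div_le_div_of_nonneg_right
              (Real.rpow_le_rpow (sub_nonneg.2 htm0) h1 hα1.le) hα1.le) hS0
        _ = S * (δ ^ (1 - α) / (1 - α)) := mul_comm _ _
    -- the estimate at the maximum point
    have hSle : S ≤ A + M' * K * (L ^ k * A) + S / 2 := by
      calc S ≤ A + M' * ∫ s in (0 : ℝ)..tm, (tm - s) ^ (-α) * d s := hle' tm htmτ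
        _ ≤ A + M' * (K * (L ^ k * A) + S * (δ ^ (1 - α) / (1 - α))) := by
            rw [hsplit]
            exact add_le_add_right (mul_le_mul_of_nonneg_left (add_le_add hpast hwin) hM'0.le) _
        _ = A + M' * K * (L ^ k * A) + S * (M' * (δ ^ (1 - α) / (1 - α))) := by ring
        _ = A + M' * K * (L ^ k * A) + S / 2 := by rw [hq]; ring
    have hAle : A ≤ L ^ k * A := le_mul_of_one_le_left hA (one_le_pow₀ hL1)
    calc d t ≤ S := hdS t htW
      _ ≤ 2 * (L ^ k * A) + 2 * (M' * K * (L ^ k * A)) := by linarith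
      _ = L ^ (k + 1) * A := by rw [pow_succ, hL]; ring

/-- **Henry's singular Grönwall inequality with constant data** (Henry 1981, Lemma 7.1.1).  For
`α < 1` and all `M`, `τ` there is `C ≥ 1` (depending on `α, M, τ` only) such that for every `A` and
every `d` continuous and nonnegative on `[0, τ]` with `d(t) ≤ A + M ∫₀ᵗ (t − s)^{−α} d(s) ds` for
all `t ∈ [0, τ]`, one has `d(t) ≤ C A` for all `t ∈ [0, τ]`.  No sign condition on `M` or `A` is
needed. [cite: Henry1981, Lemma 7.1.1] -/
theorem singular_gronwall_const {α : ℝ} (hα : α < 1) (M τ : ℝ) :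
    ∃ C : ℝ, 1 ≤ C ∧ ∀ (A : ℝ) (d : ℝ → ℝ), ContinuousOn d (Icc 0 τ) →
      (∀ t ∈ Icc 0 τ, 0 ≤ d t) →
      (∀ t ∈ Icc 0 τ, d t ≤ A + M * ∫ s in (0 : ℝ)..t, (t - s) ^ (-α) * d s) →
      ∀ t ∈ Icc 0 τ, d t ≤ C * A := by
  obtain ⟨C, hC1, hC⟩ := singular_gronwall_uniform hα M τ
  exact ⟨C, hC1, hC τ le_rfl⟩

/-- **Henry's singular Grönwall inequality with non-decreasing data** (Henry 1981, Lemma 7.1.1,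
the case of non-decreasing `a`).  For `α < 1` and all `M`, `τ` there is `C ≥ 1` (depending on
`α, M, τ` only) such that for every `a` non-decreasing on `[0, τ]` and every `d` continuous and
nonnegative on `[0, τ]` with `d(t) ≤ a(t) + M ∫₀ᵗ (t − s)^{−α} d(s) ds` for all `t ∈ [0, τ]`, one
has `d(t) ≤ C a(t)` for all `t ∈ [0, τ]` (freeze `a` at `t` and apply the uniform statement on
`[0, t]`; no sign condition on `M` or `a`). [cite: Henry1981, Lemma 7.1.1] -/
theorem singular_gronwall_monotone {α : ℝ} (hα : α < 1) (M τ : ℝ) :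
    ∃ C : ℝ, 1 ≤ C ∧ ∀ (a d : ℝ → ℝ), MonotoneOn a (Icc 0 τ) → ContinuousOn d (Icc 0 τ) →
      (∀ t ∈ Icc 0 τ, 0 ≤ d t) →
      (∀ t ∈ Icc 0 τ, d t ≤ a t + M * ∫ s in (0 : ℝ)..t, (t - s) ^ (-α) * d s) →
      ∀ t ∈ Icc 0 τ, d t ≤ C * a t := by
  obtain ⟨C, hC1, hC⟩ := singular_gronwall_uniform hα M τ
  refine ⟨C, hC1, fun a d ha hd hd0 hle t ht => ?_⟩
  have hsub : Icc 0 t ⊆ Icc 0 τ := Icc_subset_Icc_right ht.2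
  exact hC t ht.2 (a t) d (hd.mono hsub) (fun s hs => hd0 s (hsub hs))
    (fun s hs => (hle s (hsub hs)).trans (add_le_add_left (ha (hsub hs) ht hs.2) _)) t
    ⟨ht.1, le_rfl⟩

end Literature.Analysis.ODE

end
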